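import Summits.AtomisticToContinuum.Crystallization.Theorems.SquareWellLayerCakeGapTwelveToBarlowCombinatorialLayeringStep
import Summits.AtomisticToContinuum.Crystallization.Theorems.SquareWellLayerCakeGapTwelveToBarlowExtendedGapFaces

/-!
# Combinatorial layering (B1a of `GapTwelveToBarlow`): bond walks toward the centre (graph distance ≤ 60 · Euclidean distance + 1)

Crux `SquareWellLayerCake.GapTwelveToBarlow` (stmt-AtomisticToContinuum-15807), line `Sketch`,
stub `stub_develop` (H_develop), metric closure step (a): the Euclidean ball is inside the
bond-graph ball.  From **GoodFacets** (verbatim statement of `stub_goodFacets`): the thick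
`exists_step` (`exists_step_of_goodFacets`: a neighbour at inner product `≥ (2/5)‖u‖` with any
direction `u`) and the extended gap (`extendedGap_of_linkConesCover ∘ linkConesCover_of_goodFacets`:
no site at distance in `(1, 131/100)` from a four-deep Good site) give: from a site `z` at distance
`d ≥ 131/100` from `x b` there is a bonded neighbour at distance `≤ d − 1/60` from `x b`
(`d² − (4/5) d + 1 ≤ (d − 1/60)²` for `d ≥ 1.304`), and a site at distance `≤ 1` is `b` or bonded to
`b`.  Hence (`exists_walk_of_goodFacets`, anchor) every site at distance `≤ n/60` from `x b`, in a
region Good out to distance `n/60 + 5`, is joined to `b` by a bond walk of length `≤ n + 1`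
(walks coded as `c : ℕ → Fin N` with consecutive entries equal or bonded, as in `reach_of_walk`).
The constant `60` is what the cone bound `2/5` affords near `d = 1.31`; it only enters the
existential window constant of the development.  Nothing is defined; no named fact is used.
-/

noncomputable section

namespace Summit.AtomisticToContinuum.Crystallization.Theorems.SquareWellLayerCakeGapTwelveToBarlow

open Literature.Geometry.DiscreteGeometry

/-- **One step toward the centre.**  If `‖v‖ ≤ 1`, `⟪u, v⟫ ≥ (2/5)‖u‖` and `‖u‖ ≥ 131/100`, then
`‖u − v‖ ≤ ‖u‖ − 1/60`. [folklore] -/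
theorem norm_sub_le_of_step {u v : EuclideanSpace ℝ (Fin 3)} (hv : ‖v‖ ≤ 1)
    (hstep : 2 / 5 * ‖u‖ ≤ inner ℝ u v) (hu : (131 : ℝ) / 100 ≤ ‖u‖) : ‖u - v‖ ≤ ‖u‖ - 1 / 60 := by
  have h0 : 0 ≤ ‖u‖ - 1 / 60 := by linarith
  have hsq : ‖u - v‖ ^ 2 ≤ (‖u‖ - 1 / 60) ^ 2 := by
    rw [norm_sub_sq_real]
    have hv2 : ‖v‖ ^ 2 ≤ 1 := by nlinarith [norm_nonneg v]
    nlinarith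
  exact (pow_le_pow_iff_left₀ (norm_nonneg _) h0 two_ne_zero).1 hsq

/-- **Bond walks toward the centre** (anchor of this file): under GoodFacets, every site at
distance `≤ n/60` from `x b`, all sites within `n/60 + 5` of `x b` being Good, is joined to `b` by a
bond walk of length `≤ n + 1`. [folklore] -/
theorem exists_walk_of_goodFacets :
    (∀ (N : ℕ) (x : Fin N → EuclideanSpace ℝ (Fin 3)) (i : Fin N), (∀ l : Fin N, dist (x i) (x
    l) ≤ 4 → ((∀ j' : Fin N, dist (x l) (x j') ≤ 11 / 10 → ∀ k : Fin N, k ≠ j' → (55 : ℝ) / 57 ≤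
    dist (x j') (x k)) ∧ (Finset.univ.filter fun j' : Fin N => j' ≠ l ∧ dist (x l) (x j') ≤
    1).card = 12 ∧ (Finset.univ.filter fun j' : Fin N => j' ≠ l ∧ dist (x l) (x j') ≤ 11 /
    10).card ≤ 12)) → ∀ (n : EuclideanSpace ℝ (Fin 3)) (a b c : Fin N), (∀ l : Fin N, l ≠ i →
    dist (x i) (x l) ≤ 1 → inner ℝ n (x l - x i) ≤ 1) → a ≠ i → b ≠ i → c ≠ i → a ≠ b → b ≠ c →
    a ≠ c → dist (x i) (x a) ≤ 1 → dist (x i) (x b) ≤ 1 → dist (x i) (x c) ≤ 1 → inner ℝ n (x a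
    - x i) = 1 → inner ℝ n (x b - x i) = 1 → inner ℝ n (x c - x i) = 1 → (dist (x a) (x b) ≤ 1 ∧
    dist (x b) (x c) ≤ 1) ∨ (dist (x b) (x c) ≤ 1 ∧ dist (x c) (x a) ≤ 1) ∨ (dist (x c) (x a) ≤
    1 ∧ dist (x a) (x b) ≤ 1)) → ∀ (N : ℕ) (x : Fin N → EuclideanSpace ℝ (Fin 3)) (b : Fin N) (n
    : ℕ) (z : Fin N), (∀ l : Fin N, dist (x b) (x l) ≤ (n : ℝ) / 60 + 5 → ((∀ j' : Fin N, dist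
    (x l) (x j') ≤ 11 / 10 → ∀ k : Fin N, k ≠ j' → (55 : ℝ) / 57 ≤ dist (x j') (x k)) ∧
    (Finset.univ.filter fun j' : Fin N => j' ≠ l ∧ dist (x l) (x j') ≤ 1).card = 12 ∧
    (Finset.univ.filter fun j' : Fin N => j' ≠ l ∧ dist (x l) (x j') ≤ 11 / 10).card ≤ 12)) →
    dist (x b) (x z) ≤ (n : ℝ) / 60 → ∃ m : ℕ, m ≤ n + 1 ∧ ∃ c : ℕ → Fin N, c 0 = b ∧ c m = z ∧
    ∀ t : ℕ, t < m → c t = c (t + 1) ∨ dist (x (c t)) (x (c (t + 1))) ≤ 1 :=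
  by
  intro hGF N x b n
  have hGap := extendedGap_of_linkConesCover fun N x i h =>
    linkConesCover_of_goodFacets N x i h (hGF N x i h)
  induction n with
  | zero =>
    intro z hgood hd
    have hb := (hgood b (by rw [dist_self]; positivity)).1 b (by rw [dist_self]; norm_num)
    have hzb : z = b := by
      by_contra hne
      have := hb z hne
      simp only [Nat.cast_zero, zero_div] at hd
      linarith
    exact ⟨0, by omega, fun _ => b, rfl, hzb.symm, fun t ht => absurd ht (Nat.not_lt_zero _)⟩
  | succ n ih =>
    intro z hgood hd
    by_cases h1 : dist (x b) (x z) ≤ 1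
    · by_cases hzb : z = b
      · exact ⟨0, by omega, fun _ => b, rfl, hzb.symm, fun t ht => absurd ht (Nat.not_lt_zero _)⟩
      · refine ⟨1, by omega, fun t => if t = 0 then b else z, by simp, by simp, ?_⟩
        intro t ht
        have ht0 : t = 0 := by omega
        subst ht0
        right; simpa using h1
    · push Not at h1
      -- four-deep Goodness at `b` and at `z`
      have hgb : ∀ l : Fin N, dist (x b) (x l) ≤ 4 → _ := fun l hl => hgood l (by
        have : (0 : ℝ) ≤ ((n + 1 : ℕ) : ℝ) / 60 := by positivity
        linarith)
      have hgz : ∀ l : Fin N, dist (x z) (x l) ≤ 4 → _ := fun l hl => hgood l (by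
        linarith [dist_triangle (x b) (x z) (x l)])
      have h131 : (131 : ℝ) / 100 ≤ dist (x b) (x z) := hGap N x b z hgb h1
      obtain ⟨l, hlz, hdl, hstep⟩ := exists_step_of_goodFacets hGF N x z hgz (x b - x z)
      have hnew : dist (x b) (x l) ≤ dist (x b) (x z) - 1 / 60 := by
        have e1 : dist (x b) (x l) = ‖(x b - x z) - (x l - x z)‖ := by
          rw [sub_sub_sub_cancel_right, dist_eq_norm]
        have e2 : dist (x b) (x z) = ‖x b - x z‖ := dist_eq_norm _ _
        rw [e1, e2]
        refine norm_sub_le_of_step ?_ hstep (by rw [← e2]; exact h131)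
        rw [← dist_eq_norm, dist_comm]; exact hdl
      have hdn : dist (x b) (x l) ≤ (n : ℝ) / 60 := by
        have : ((n + 1 : ℕ) : ℝ) / 60 = (n : ℝ) / 60 + 1 / 60 := by push_cast; ring
        linarith
      obtain ⟨m, hm, c, hc0, hcm, hw⟩ := ih l (fun l' hl' => hgood l' (by
        have : ((n + 1 : ℕ) : ℝ) / 60 = (n : ℝ) / 60 + 1 / 60 := by push_cast; ring
        linarith)) hdn
      refine ⟨m + 1, by omega, fun t => if t ≤ m then c t else z, by simp [hc0], by simp, ?_⟩
      intro t ht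
      show (if t ≤ m then c t else z) = (if t + 1 ≤ m then c (t + 1) else z) ∨
        dist (x (if t ≤ m then c t else z)) (x (if t + 1 ≤ m then c (t + 1) else z)) ≤ 1
      by_cases htm : t < m
      · rw [if_pos (by omega), if_pos (by omega)]; exact hw t htm
      · have htm' : t = m := by omega
        subst htm'
        rw [if_pos le_rfl, if_neg (by omega), hcm]
        right; rw [dist_comm]; exact hdl

end Summit.AtomisticToContinuum.Crystallization.Theorems.SquareWellLayerCakeGapTwelveToBarlow
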